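import Literature.NumberTheory.LFunctions.Zhang2022.MainTermFormEll
import Literature.NumberTheory.LFunctions.Zhang2022.RepairVerdictAssembly
import HarnessLib

/-!
# Zhang (2022): the deformed main-term form `F_ℓ` in §2 currency — polar form and the three
# constants `C₂₃₂^{(ℓ)}, C₂₃₃^{(ℓ)}, (𝔡+𝔡′)^{(ℓ)}` on the repair cell's designs (cell `landau-siegel`, edge `ℓ₀ = 1`)

Topic `Literature/NumberTheory/LFunctions/Zhang2022` (Landau–Siegel audit tree; verdict-neutral).
Y. Zhang, arXiv:2211.02515v1 (2022) [Zhang2022LandauSiegel] — an unrefereed manuscript under adjudication;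
NOTHING here asserts or denies its Theorems 1–2, and nothing here is a claim about Landau–Siegel zeros.

`MainTermFormEll` defines the one-parameter deformation `F_ℓ = mainTermFormEll ℓ` of the main-term form
`𝔅 = mainTermForm` (`F₁ = 𝔅`, `mainTermFormEll_one`) and proves the knife edge `mainTermFormEll_neg_of_one_lt`.
The cell's objective (OBJECTIVE.md §2.2, row ell) evaluates designs with «`F_ℓ` in ALL THREE constants, polar by
polarisation» (numerics lineage B, kit j251235, HEURISTIC matched units: at the printed design `θ₀`,
`min_ι C₂₃₂^{(ℓ)} = 0.0249294 − 35.72ε`, joint criterion met by `ι` from `ε = ℓ − 1 ≈ 3.14·10⁻⁴`), and the B-ell registry rows E-021/E-022 speak of «the three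
normalised means = their `mainTermFormEll (L_R/L_Δ)` VALUES». The cross constant `𝔡+𝔡′` is a POLAR value, and the
tree has the polar form only at `ℓ = 1` (`mainTermFormPolar`, `MainTermFormCauchySchwarz`). This file supplies:

* `mainTermFormEllSesq ℓ u u' v v'` — the six terms of `mainTermFormSesq` weighted `1, ℓ, ℓ², ℓ³` by homogeneity
  class exactly as in `mainTermFormEll` — and its Hermitian part `mainTermFormEllPolar ℓ`; PROVED:
  `Re s_ℓ(g,g) = F_ℓ(g)` (`mainTermFormEllSesq_self_re`), `P_ℓ(g,g) = F_ℓ(g)`, `s₁ = mainTermFormSesq`,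
  `P₁ = mainTermFormPolar`;
* on the repair cell's designs `θ : Repair.Theta` (glued `H`-profile `Repair.gluedS θ`, tent `Repair.tentT θ`):
  `C232Ell ℓ θ := F_ℓ(𝔤_θ)`, `C233Ell ℓ θ := F_ℓ(f_θ)`, `dSumEll ℓ θ := P_ℓ(𝔤_θ, f_θ)`; PROVED at `ℓ = 1` on the
  admissible class: `= Repair.C232S θ`, `= Repair.C233T θ`, `= Repair.dSumS θ` (the dictionary of record
  `Repair.h232_on_class / h233_on_class / hsum_on_class`);
* the two DECISION SHAPES of the edge as `Prop`s with their `ℓ = 1` / `ℓ > 1` status PROVED: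
  `EllClosesCS ℓ := ∃ θ, AdmissibleTheta θ ∧ C232Ell·C233Ell < ‖dSumEll‖²` — FALSE at `ℓ = 1`
  (`not_ellClosesCS_one`, = the verdict of record `Repair.not_repairable_true_need`, p428635); and
  `EllClosesPos ℓ := ∃ C¹ g, F_ℓ(g) < 0` — TRUE at every `ℓ > 1` (`ellClosesPos_of_one_lt`, = the knife edge
  `mainTermFormEll_not_nonneg_of_one_lt`): a design «closes» in these currencies the moment `ℓ ≠ 1` is fed to the
  continued calculus, which is why every ℓ-statement of substance is a DICTIONARY / ZERO-MODEL hypothesis at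
  free scales (`KnifeEdgeEllScales`), not a statement about `F_ℓ`.

STATUS OF THE OBJECTS (stated, not hidden — as in `MainTermFormEll`): for `ℓ ≠ 1` these are values of the
CONTINUED main-term calculus with the zero-spacing scale deformed; that the manuscript's three normalised means at
`P = D^A` equal them (to some relative error) is registry row E-021/E-022 — OPEN, asserted by no one here.
Deliberately NOT here: any numerical value of record as a theorem; the free-scale discrete means (`KnifeEdgeEllScales`).

## References
* Y. Zhang, arXiv:2211.02515v1 (2022), §2 (2.10), (2.17)–(2.18), (2.32)–(2.33); §10 (10.1), (10.17).
  [cite: Zhang2022LandauSiegel, §2]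
-/

noncomputable section

open MeasureTheory Set intervalIntegral
open scoped Real ComplexConjugate

namespace Literature.NumberTheory.LFunctions.Zhang2022

/-! ## `F_ℓ` polarised -/

/-- **The ℓ-weighted sesquilinear form** `s_ℓ(u,v) = (8/π)⟨u′,v′⟩ + ℓ[−48i⟨u′,v⟩ − 16i u(0)v̄(1)]
+ ℓ²[88π⟨u,v⟩ − 24π conj(S_v(1))(u(0)+u(1))] + ℓ³[−48π²i⟨u,S_v⟩]` (`⟨a,b⟩ = ∫₀¹ a b̄`, `S_v(x) = ∫₀ˣ v`): the six
terms of `mainTermFormSesq` weighted by homogeneity class as in `mainTermFormEll` (the scaling `π ↦ πℓ` of the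
zero gap (2.10), times `ℓ`). [cite: Zhang2022LandauSiegel, §2 (2.10), (2.17)–(2.18)] -/
def mainTermFormEllSesq (ℓ : ℝ) (u u' v v' : ℝ → ℂ) : ℂ :=
  ((8 / π : ℝ) : ℂ) * (∫ x in (0:ℝ)..1, u' x * conj (v' x))
    + (ℓ : ℂ) * (- ((48 : ℝ) : ℂ) * Complex.I * (∫ x in (0:ℝ)..1, u' x * conj (v x))
        - ((16 : ℝ) : ℂ) * Complex.I * (u 0 * conj (v 1)))
    + ((ℓ ^ 2 : ℝ) : ℂ) * (((88 * π : ℝ) : ℂ) * (∫ x in (0:ℝ)..1, u x * conj (v x))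
        - ((24 * π : ℝ) : ℂ) * (conj (∫ t in (0:ℝ)..1, v t) * (u 0 + u 1)))
    + ((ℓ ^ 3 : ℝ) : ℂ) * (- ((48 * π ^ 2 : ℝ) : ℂ) * Complex.I *
        (∫ x in (0:ℝ)..1, u x * conj (∫ t in (0:ℝ)..x, v t)))

/-- **The polar (Hermitian) form `P_ℓ(u,v) = (s_ℓ(u,v) + conj s_ℓ(v,u))/2` of `F_ℓ`.**
[cite: Zhang2022LandauSiegel, §2 (2.10), (2.17)–(2.18)] -/
def mainTermFormEllPolar (ℓ : ℝ) (u u' v v' : ℝ → ℂ) : ℂ :=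
  (mainTermFormEllSesq ℓ u u' v v' + conj (mainTermFormEllSesq ℓ v v' u u')) / 2

/-- `Re s_ℓ(g,g) = F_ℓ(g)` (no hypothesis on `g`: both sides are the same integrals).
[cite: Zhang2022LandauSiegel, §2 (2.10), (2.17)–(2.18)] -/
theorem mainTermFormEllSesq_self_re (ℓ : ℝ) (g g' : ℝ → ℂ) :
    (mainTermFormEllSesq ℓ g g' g g').re = mainTermFormEll ℓ g g' := by
  rw [mainTermFormEll, mainTermFormEllSesq, intervalIntegral_mul_conj_self g',
    intervalIntegral_mul_conj_self g]
  simp only [Complex.add_re, Complex.sub_re, Complex.mul_re, Complex.mul_im, Complex.ofReal_re,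
    Complex.ofReal_im, Complex.I_re, Complex.I_im, Complex.conj_re, Complex.conj_im,
    Complex.add_im, Complex.neg_re, Complex.neg_im, Complex.sub_im]
  ring

/-- `P_ℓ(g,g) = F_ℓ(g)`. [cite: Zhang2022LandauSiegel, §2 (2.10), (2.17)–(2.18)] -/
theorem mainTermFormEllPolar_self (ℓ : ℝ) (g g' : ℝ → ℂ) :
    mainTermFormEllPolar ℓ g g' g g' = (mainTermFormEll ℓ g g' : ℂ) := by
  rw [mainTermFormEllPolar, ← mainTermFormEllSesq_self_re, Complex.add_conj]
  push_cast
  ring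

/-- Hermitian symmetry `P_ℓ(v,u) = conj P_ℓ(u,v)`. [cite: Zhang2022LandauSiegel, §2 (2.17)–(2.18)] -/
theorem mainTermFormEllPolar_swap (ℓ : ℝ) (u u' v v' : ℝ → ℂ) :
    mainTermFormEllPolar ℓ v v' u u' = conj (mainTermFormEllPolar ℓ u u' v v') := by
  simp only [mainTermFormEllPolar, map_div₀, map_add, Complex.conj_conj, Complex.conj_ofNat, add_comm]

/-- At `ℓ = 1` the sesquilinear form is `mainTermFormSesq`. [cite: Zhang2022LandauSiegel, §2 (2.10), (2.17)–(2.18)] -/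
theorem mainTermFormEllSesq_one (u u' v v' : ℝ → ℂ) :
    mainTermFormEllSesq 1 u u' v v' = mainTermFormSesq u u' v v' := by
  rw [mainTermFormEllSesq, mainTermFormSesq]
  push_cast
  ring

/-- At `ℓ = 1` the polar form is `mainTermFormPolar` (the form of the Cauchy–Schwarz verdict).
[cite: Zhang2022LandauSiegel, §2 (2.10), (2.17)–(2.18)] -/
theorem mainTermFormEllPolar_one (u u' v v' : ℝ → ℂ) :
    mainTermFormEllPolar 1 u u' v v' = mainTermFormPolar u u' v v' := by
  rw [mainTermFormEllPolar, mainTermFormPolar, mainTermFormEllSesq_one, mainTermFormEllSesq_one]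

/-! ## The three constants in ℓ-currency on the repair cell's designs -/

/-- **`C₂₃₂^{(ℓ)}(θ) := F_ℓ(𝔤_θ)`** — the (2.32)-side constant with `𝔅` replaced by `F_ℓ` on the glued `H`-profile
`Repair.gluedS θ` (at `ℓ = 1`: `Repair.C232S θ`, `C232Ell_one`). [cite: Zhang2022LandauSiegel, §2 (2.32), §18 (18.1)] -/
def C232Ell (ℓ : ℝ) (θ : Repair.Theta) : ℝ := mainTermFormEll ℓ (Repair.gluedS θ) (Repair.gluedS' θ)

/-- **`C₂₃₃^{(ℓ)}(θ) := F_ℓ(f_θ)`** — the (2.33)-side constant with `𝔅` replaced by `F_ℓ` on the tent `Repair.tentT θ`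
(at `ℓ = 1` on the class: `Repair.C233T θ`, `C233Ell_one`). [cite: Zhang2022LandauSiegel, §2 (2.33), §10 (10.19)] -/
def C233Ell (ℓ : ℝ) (θ : Repair.Theta) : ℝ := mainTermFormEll ℓ (Repair.tentT θ) (Repair.tentT' θ)

/-- **`(𝔡+𝔡′)^{(ℓ)}(θ) := P_ℓ(𝔤_θ, f_θ)`** — the cross main term of (10.17) with the polar form of `F_ℓ`
(at `ℓ = 1` on the class: `Repair.dSumS θ`, `dSumEll_one`). [cite: Zhang2022LandauSiegel, §2 (2.17), §10 (10.1), (10.17)] -/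
def dSumEll (ℓ : ℝ) (θ : Repair.Theta) : ℂ :=
  mainTermFormEllPolar ℓ (Repair.gluedS θ) (Repair.gluedS' θ) (Repair.tentT θ) (Repair.tentT' θ)

/-- `C₂₃₂^{(1)} = C232S` (for every design). [cite: Zhang2022LandauSiegel, §2 (2.32), §18 (18.1)] -/
theorem C232Ell_one (θ : Repair.Theta) : C232Ell 1 θ = Repair.C232S θ := by
  rw [C232Ell, mainTermFormEll_one, Repair.C232S_eq_form]

/-- `C₂₃₃^{(1)} = C233T` on the admissible class. [cite: Zhang2022LandauSiegel, §2 (2.33), §10 (10.19)] -/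
theorem C233Ell_one {θ : Repair.Theta} (h : Repair.AdmissibleTheta θ) : C233Ell 1 θ = Repair.C233T θ := by
  rw [C233Ell, mainTermFormEll_one, Repair.h233_on_class θ h]

/-- `(𝔡+𝔡′)^{(1)} = dSumS` on the admissible class. [cite: Zhang2022LandauSiegel, §10 (10.1), (10.17)] -/
theorem dSumEll_one {θ : Repair.Theta} (h : Repair.AdmissibleTheta θ) : dSumEll 1 θ = Repair.dSumS θ := by
  rw [dSumEll, mainTermFormEllPolar_one, Repair.hsum_on_class θ h]

/-! ## The two decision shapes of the edge, with their `ℓ = 1` / `ℓ > 1` status -/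

/-- **CS currency**: «some admissible design meets the joint main-order criterion once `𝔅` is replaced by `F_ℓ`»,
`∃ θ, AdmissibleTheta θ ∧ C₂₃₂^{(ℓ)}·C₂₃₃^{(ℓ)} < |(𝔡+𝔡′)^{(ℓ)}|²` — the event the cell's lineage-B numerics study
(README L11 §5, kit j251235: met by `ι` at the printed design from `ε = ℓ − 1 ≈ 3.14·10⁻⁴`, HEURISTIC matched units,
lengths re-expressed in `L_R` units); FALSE at `ℓ = 1` (`not_ellClosesCS_one`). A `Prop`; nothing asserted for `ℓ ≠ 1`. [cite: Zhang2022LandauSiegel, §2 Props. 2.4–2.6, (2.32)–(2.33)] -/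
def EllClosesCS (ℓ : ℝ) : Prop :=
  ∃ θ : Repair.Theta, Repair.AdmissibleTheta θ ∧ C232Ell ℓ θ * C233Ell ℓ θ < ‖dSumEll ℓ θ‖ ^ 2

/-- At `ℓ = 1` the CS decision statement is the negation of the verdict of record
`Repair.not_repairable_true_need` (NOT-REPAIRABLE-IN-CLASS, p428635): it fails.
[cite: Zhang2022LandauSiegel, §2 Props. 2.4–2.6, (2.32)–(2.33)] -/
theorem not_ellClosesCS_one : ¬ EllClosesCS 1 := by
  rintro ⟨θ, hθ, hlt⟩
  rw [C232Ell_one, C233Ell_one hθ, dSumEll_one hθ] at hlt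
  exact Repair.not_repairable_true_need θ hθ hlt

/-- **POS currency**: «`F_ℓ` is negative on some `C¹` profile». [cite: Zhang2022LandauSiegel, §2 (2.10), (2.18)] -/
def EllClosesPos (ℓ : ℝ) : Prop := ∃ g g' : ℝ → ℂ, IsC1OnUnitInterval g g' ∧ mainTermFormEll ℓ g g' < 0

/-- … which HOLDS at every `ℓ > 1` (the knife edge `mainTermFormEll_not_nonneg_of_one_lt`): in POS currency the
continued calculus «closes» the moment `ℓ > 1` is fed to it, so an ℓ-statement of substance is the dictionary /
zero-model hypothesis that feeds it (free scales, `KnifeEdgeEllScales`), not this. [cite: Zhang2022LandauSiegel, §2 (2.10), (2.18)] -/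
theorem ellClosesPos_of_one_lt {ℓ : ℝ} (hℓ : 1 < ℓ) : EllClosesPos ℓ :=
  mainTermFormEll_not_nonneg_of_one_lt hℓ

/-- … and FAILS at `ℓ = 1` (`F₁ = 𝔅 ≥ 0` on `C¹` profiles, `mainTermFormEll_one_nonneg`).
[cite: Zhang2022LandauSiegel, §2 (2.10), (2.18)] -/
theorem not_ellClosesPos_one : ¬ EllClosesPos 1 := by
  rintro ⟨g, g', hg, hneg⟩
  exact not_lt.2 (mainTermFormEll_one_nonneg hg) hneg

end Literature.NumberTheory.LFunctions.Zhang2022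

end
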